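import Summits.SmoothPoincare4.SmoothPoincare4.Theses.CommonDualRelay

/-!
# Line `immersed-then-embed` — crux `OneSummandCommonDuals` (stmt-SmoothPoincare4-15789), route CommonDualRelay

Strategist skeleton (unit cstrat-stmt-SmoothPoincare4-15789-r1).  The crux R is cut along the two stages of the
Auckly–Kim–Melvin–Ruberman–Schwartz argument (arXiv:1708.03208 p. 4):

* `stub_framedImmersedCommonDuals` (D3a) — IMMERSED STAGE for the GIVEN systems: framed-immersed common duals
  (local diffeomorphisms `S² × ℝ² → N`, zero sections geometrically dual as maps to both `A` and `C`), off the free pair.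
  QUARANTINED: as typed (fixed `A`, `C`) this is NOT in print even at `k = 1` (AKMRS finger-move `F₀` first) and carries a
  meridian-conjugacy obstruction in `π₁(N ∖ (A ∪ C))` that no external stabilisation touches — see `Lines/immersed-then-embed.md`
  and `VERDICT-r1.md`; do not staff before the negation probe / the recommended restatement of R.
* `stub_embeddingRelay` (D3b) — EMBEDDING RELAY, the summand budget: `k` framed-immersed common duals + ONE free framed
  dual pair ⇒ `k` disjoint embedded framed common duals.  `k = 1` = AKMRS p. 4 (tube into `S`, Norman trick along `T`,
  square fixed by copies of `T`); `k ≥ 2` open.  This stub is invariant under the recommended restatement (it is also the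
  second piece of `OneSummandCarrier`).  THE HARDEST STUB.
* `OneSummandCommonDuals_of : D3a → D3b → OneSummandCommonDuals` — kernel-checked composition (pure logic).
-/

namespace Summit.SmoothPoincare4.SmoothPoincare4.Cruxes.OneSummandCommonDuals.ImmersedThenEmbed

open scoped Manifold ContinuousMap
open Summit.SmoothPoincare4.SmoothPoincare4.Theses.CommonDualRelay

set_option linter.dupNamespace false

/-- D3a — framed-immersed common duals for the GIVEN pair of dual-equipped systems (quarantined; see the module doc). -/
theorem stub_framedImmersedCommonDuals :
    open scoped ContDiff in ∀ (N : Type) [TopologicalSpace N] [T2Space N] [SecondCountableTopology N] [ChartedSpace (EuclideanSpace ℝ (Fin 4)) N] [IsManifold (𝓡 4) ∞ N] [CompactSpace N] [SimplyConnectedSpace N] (oN : Literature.Topology.FourManifolds.SmoothOrientation (𝓡 4) N) (oS : Literature.Topology.FourManifolds.SmoothOrientation (𝓡 2) (Metric.sphere (0 : EuclideanSpace ℝ (Fin 3)) 1)) (k : ℕ) (A G C P : Literature.Topology.FourManifolds.FramedSphereFamily (𝓡 4) N (Fin k) 2 2) (F T : Literature.Topology.FourManifolds.FramedSphereFamily (𝓡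 4) N (Fin 1) 2 2), Literature.Topology.FourManifolds.IsGeometricallyDual (𝓡 2) (𝓡 2) (𝓡 4) two_add_two_eq_four oS oS oN G.sphere A.sphere → Literature.Topology.FourManifolds.IsGeometricallyDual (𝓡 2) (𝓡 2) (𝓡 4) two_add_two_eq_four oS oS oN C.sphere P.sphere → (∀ i, (⟨A.sphere i, A.continuous_sphere i⟩ : C(↥(Metric.sphere (0 : EuclideanSpace ℝ (Fin 3)) 1), N)).Homotopic ⟨C.sphere i, C.continuous_sphere i⟩) → Literature.Topology.FourManifolds.IsGeometricallyDual (𝓡 2) (𝓡 2) (𝓡 4) two_add_two_eq_four oS oS oN F.sphere T.sphere → Disjoint (F.cores ∪ T.cores) (A.cores ∪ G.cores ∪ C.cores ∪ P.cores) → ∃ ψ : Fin k → ↥(Metric.sphere (0 : EuclideanSpace ℝ (Fin 3)) 1) × (EuclideanSpace ℝ (Fin 2)) → N, (∀ i, IsLocalDiffeomorph ((𝓡 2).prod 𝓘(ℝ, (EuclideanSpace ℝ (Fin 2)))) (𝓡 4) ∞ (ψ i)) ∧ Literature.Topology.FourManifolds.IsGeometricallyDual (𝓡 2) (𝓡 2)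 (𝓡 4) two_add_two_eq_four oS oS oN (fun i v => ψ i (v, 0)) A.sphere ∧ Literature.Topology.FourManifolds.IsGeometricallyDual (𝓡 2) (𝓡 2) (𝓡 4) two_add_two_eq_four oS oS oN (fun i v => ψ i (v, 0)) C.sphere ∧ Disjoint (F.cores ∪ T.cores) (⋃ i, Set.range (ψ i)) := by
  sorry

/-- D3b — the embedding relay: `k` framed-immersed common duals and ONE free framed dual pair give `k` pairwise disjoint
embedded framed common duals (AucklyEtAl2019 p. 4 for `k = 1`; open for `k ≥ 2`). -/
theorem stub_embeddingRelay :
    open scoped ContDiff in ∀ (N : Type) [TopologicalSpace N] [T2Space N] [SecondCountableTopology N] [ChartedSpace (EuclideanSpace ℝ (Fin 4)) N] [IsManifold (𝓡 4) ∞ N] [CompactSpace N] [SimplyConnectedSpace N] (oN : Literature.Topology.FourManifolds.SmoothOrientation (𝓡 4) N) (oS : Literature.Topology.FourManifolds.SmoothOrientation (𝓡 2) (Metric.sphere (0 : EuclideanSpace ℝ (Fin 3)) 1)) (k : ℕ) (A G C P : Literature.Topology.FourManifolds.FramedSphereFamily (𝓡 4) N (Fin k) 2 2) (F T : Literature.Topology.FourManifolds.FramedSphereFamily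 (𝓡 4) N (Fin 1) 2 2) (ψ : Fin k → ↥(Metric.sphere (0 : EuclideanSpace ℝ (Fin 3)) 1) × (EuclideanSpace ℝ (Fin 2)) → N), (∀ i, IsLocalDiffeomorph ((𝓡 2).prod 𝓘(ℝ, (EuclideanSpace ℝ (Fin 2)))) (𝓡 4) ∞ (ψ i)) → Literature.Topology.FourManifolds.IsGeometricallyDual (𝓡 2) (𝓡 2) (𝓡 4) two_add_two_eq_four oS oS oN G.sphere A.sphere → Literature.Topology.FourManifolds.IsGeometricallyDual (𝓡 2) (𝓡 2) (𝓡 4) two_add_two_eq_four oS oS oN C.sphere P.sphere → Literature.Topology.FourManifolds.IsGeometricallyDual (𝓡 2) (𝓡 2) (𝓡 4) two_add_two_eq_four oS oS oN (fun i v => ψ i (v, 0)) A.sphere → Literature.Topology.FourManifolds.IsGeometricallyDual (𝓡 2) (𝓡 2) (𝓡 4) two_add_two_eq_four oS oS oN (fun i v => ψ i (v, 0)) C.sphere → Literature.Topology.FourManifolds.IsGeometricallyDual (𝓡 2) (𝓡 2) (𝓡 4) two_add_two_eq_four oS oS oN F.sphere T.sphere → Disjoint (F.cores ∪ T.cores)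 (A.cores ∪ G.cores ∪ C.cores ∪ P.cores ∪ ⋃ i, Set.range (ψ i)) → ∃ σ : Literature.Topology.FourManifolds.FramedSphereFamily (𝓡 4) N (Fin k) 2 2, Literature.Topology.FourManifolds.IsGeometricallyDual (𝓡 2) (𝓡 2) (𝓡 4) two_add_two_eq_four oS oS oN σ.sphere A.sphere ∧ Literature.Topology.FourManifolds.IsGeometricallyDual (𝓡 2) (𝓡 2) (𝓡 4) two_add_two_eq_four oS oS oN σ.sphere C.sphere := by
  sorry

/-- Composition: the two stubs give the crux BY NAME. -/
theorem OneSummandCommonDuals_of :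
    (open scoped ContDiff in ∀ (N : Type) [TopologicalSpace N] [T2Space N] [SecondCountableTopology N] [ChartedSpace (EuclideanSpace ℝ (Fin 4)) N] [IsManifold (𝓡 4) ∞ N] [CompactSpace N] [SimplyConnectedSpace N] (oN : Literature.Topology.FourManifolds.SmoothOrientation (𝓡 4) N) (oS : Literature.Topology.FourManifolds.SmoothOrientation (𝓡 2) (Metric.sphere (0 : EuclideanSpace ℝ (Fin 3)) 1)) (k : ℕ) (A G C P : Literature.Topology.FourManifolds.FramedSphereFamily (𝓡 4) N (Fin k) 2 2) (F T : Literature.Topology.FourManifolds.FramedSphereFamily (𝓡 4) N (Fin 1) 2 2), Literature.Topology.FourManifolds.IsGeometricallyDual (𝓡 2) (𝓡 2) (𝓡 4) two_add_two_eq_four oS oS oN G.sphere A.sphere → Literature.Topology.FourManifolds.IsGeometricallyDual (𝓡 2) (𝓡 2) (𝓡 4) two_add_two_eq_four oS oS oN C.sphere P.sphere → (∀ i, (⟨A.sphere i, A.continuous_sphere i⟩ : C(↥(Metric.sphere (0 : EuclideanSpace ℝ (Fin 3)) 1), N)).Homotopic ⟨C.sphere i, C.continuous_sphere i⟩) → Literature.Topology.FourManifolds.IsGeometricallyDual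 (𝓡 2) (𝓡 2) (𝓡 4) two_add_two_eq_four oS oS oN F.sphere T.sphere → Disjoint (F.cores ∪ T.cores) (A.cores ∪ G.cores ∪ C.cores ∪ P.cores) → ∃ ψ : Fin k → ↥(Metric.sphere (0 : EuclideanSpace ℝ (Fin 3)) 1) × (EuclideanSpace ℝ (Fin 2)) → N, (∀ i, IsLocalDiffeomorph ((𝓡 2).prod 𝓘(ℝ, (EuclideanSpace ℝ (Fin 2)))) (𝓡 4) ∞ (ψ i)) ∧ Literature.Topology.FourManifolds.IsGeometricallyDual (𝓡 2) (𝓡 2) (𝓡 4) two_add_two_eq_four oS oS oN (fun i v => ψ i (v, 0)) A.sphere ∧ Literature.Topology.FourManifolds.IsGeometricallyDual (𝓡 2) (𝓡 2) (𝓡 4) two_add_two_eq_four oS oS oN (fun i v => ψ i (v, 0)) C.sphere ∧ Disjoint (F.cores ∪ T.cores) (⋃ i, Set.range (ψ i))) →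
    (open scoped ContDiff in ∀ (N : Type) [TopologicalSpace N] [T2Space N] [SecondCountableTopology N] [ChartedSpace (EuclideanSpace ℝ (Fin 4)) N] [IsManifold (𝓡 4) ∞ N] [CompactSpace N] [SimplyConnectedSpace N] (oN : Literature.Topology.FourManifolds.SmoothOrientation (𝓡 4) N) (oS : Literature.Topology.FourManifolds.SmoothOrientation (𝓡 2) (Metric.sphere (0 : EuclideanSpace ℝ (Fin 3)) 1)) (k : ℕ) (A G C P : Literature.Topology.FourManifolds.FramedSphereFamily (𝓡 4) N (Fin k) 2 2) (F T : Literature.Topology.FourManifolds.FramedSphereFamily (𝓡 4) N (Fin 1) 2 2) (ψ : Fin k → ↥(Metric.sphere (0 : EuclideanSpace ℝ (Fin 3)) 1) × (EuclideanSpace ℝ (Fin 2)) → N), (∀ i, IsLocalDiffeomorph ((𝓡 2).prod 𝓘(ℝ, (EuclideanSpace ℝ (Fin 2)))) (𝓡 4) ∞ (ψ i)) → Literature.Topology.FourManifolds.IsGeometricallyDual (𝓡 2) (𝓡 2) (𝓡 4) two_add_two_eq_four oS oS oN G.sphere A.sphere → Literature.Topology.FourManifolds.IsGeometricallyDual (𝓡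 2) (𝓡 2) (𝓡 4) two_add_two_eq_four oS oS oN C.sphere P.sphere → Literature.Topology.FourManifolds.IsGeometricallyDual (𝓡 2) (𝓡 2) (𝓡 4) two_add_two_eq_four oS oS oN (fun i v => ψ i (v, 0)) A.sphere → Literature.Topology.FourManifolds.IsGeometricallyDual (𝓡 2) (𝓡 2) (𝓡 4) two_add_two_eq_four oS oS oN (fun i v => ψ i (v, 0)) C.sphere → Literature.Topology.FourManifolds.IsGeometricallyDual (𝓡 2) (𝓡 2) (𝓡 4) two_add_two_eq_four oS oS oN F.sphere T.sphere → Disjoint (F.cores ∪ T.cores) (A.cores ∪ G.cores ∪ C.cores ∪ P.cores ∪ ⋃ i, Set.range (ψ i)) → ∃ σ : Literature.Topology.FourManifolds.FramedSphereFamily (𝓡 4) N (Fin k) 2 2, Literature.Topology.FourManifolds.IsGeometricallyDual (𝓡 2) (𝓡 2) (𝓡 4) two_add_two_eq_four oS oS oN σ.sphere A.sphere ∧ Literature.Topology.FourManifolds.IsGeometricallyDual (𝓡 2) (𝓡 2) (𝓡 4) two_add_two_eq_four oS oS oN σ.sphere C.sphere) →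
    Summit.SmoothPoincare4.SmoothPoincare4.Theses.CommonDualRelay.OneSummandCommonDuals := by
  intro h₁ h₂ N _ _ _ _ _ _ _ oN oS k A G C P F T hGA hCP hAC hFT hdisj
  obtain ⟨ψ, hψ, hψA, hψC, hdisjψ⟩ := h₁ N oN oS k A G C P F T hGA hCP hAC hFT hdisj
  exact h₂ N oN oS k A G C P F T ψ hψ hGA hCP hψA hψC hFT (Disjoint.union_right hdisj hdisjψ)

/-- The crux, closed modulo the two stubs. -/
theorem oneSummandCommonDuals_holds_of_stubs :
    Summit.SmoothPoincare4.SmoothPoincare4.Theses.CommonDualRelay.OneSummandCommonDuals :=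
  OneSummandCommonDuals_of stub_framedImmersedCommonDuals stub_embeddingRelay

end Summit.SmoothPoincare4.SmoothPoincare4.Cruxes.OneSummandCommonDuals.ImmersedThenEmbed
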